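import Summits.BirchSwinnertonDyer.Rank1Residual.X11b.BDPRouteRigidity
import Summits.BirchSwinnertonDyer.Rank1Residual.X11b.CastellaErratum
import HarnessLib

/-!
# Class X11b, route "BDP + converse-theorem engine + Kolyvagin": which ANNOUNCED statements discharge the typed input STEP L, and on which pairs (cell `b2b-bsdres`, sub-cell `multr1-p2`, gen 5)

HONEST FRAMING (cell `b2b-bsdres`, run/shared/lean/b2b/bsd-rank1-residual/, verbatim in every
file): the goal of the cell is to DELETE the COMBINATION-SHAPED residual classes of the
Birch–Swinnerton-Dyer formula for ALL analytic-rank `≤ 1` elliptic curves over `ℚ` — "full BSD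
formula for every rank `≤ 1` curve in class `C`" assembled STRICTLY from published theorems — so
that the rank-`≤ 1` remainder becomes exactly the CONSTRUCTION-SHAPED classes, which are TYPED
(missing-input `Prop`s), NOT attempted. This is not "finishing BSD". Sub-cell `multr1-p2` is a
RESEARCH ROUTE on class X11b (`ClassX11b W p := r_an = 1 ∧ p ≠ 2 ∧ mult(p) ∧ irr(p)`,
`Partition/Rows.lean`); no claim beyond the stated class and loci; X11b's label does not change.
An ANNOUNCED / unrefereed statement enters ONLY as an explicitly labelled OPEN binder.

THEOREMS ONLY (no definition, no named fact). By `X11b/BDPRouteRigidity.lean` the route's typed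
input STEP L (`IndexLowerBoundAt W p K P`, OPEN at `p ∥ N`) at a Heegner datum is EQUIVALENT to
the main-conjecture half of `BSD(E,p)`; so every source of `BSD(E,p)` discharges it. The two
ANNOUNCED rank-one statements at `p ∥ N` are typed in the tree as OPEN binders with their printed
hypotheses — Castella's erratum Thm. A′ (`Castella2018.erratum_thmAprime_padicVal_bsd_rankOne_OPEN`;
proof via Fouquet–Wan arXiv:2107.13726 Thm. 4.41, unrefereed) and Skinner–Zhang arXiv:1407.1099
Thm. 1.2 (`SkinnerZhang2014.thm1_2_padicVal_bsd_rankOne_OPEN`, unrefereed since 2014) — and turned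
into `BSDp` on their shapes by `bsdp_of_erratumHypotheses_of_thmAprime_OPEN` (`X11b/CastellaErratum.lean`)
and `bsdp_of_skinnerZhang_OPEN` (`Rank1Residual/X11.lean`). This file composes:

* `indexLowerBoundAt_of_skinnerZhang_OPEN` — CONDITIONAL on the OPEN binder SZ14: at every pair
  `(E,p)`, `p ≥ 5`, satisfying Skinner–Zhang's hypotheses (a)–(e) with `ord_{s=1} L(E,s) = 1`, STEP L
  holds at EVERY Heegner datum (any `d_K`; `p ∤ #𝓞_K^×`, `L(E^{d_K},1) ≠ 0`, `p ∤ c`).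
* `indexLowerBoundAt_of_thmAprime_OPEN` — CONDITIONAL on the OPEN binder A′: the same at every pair
  satisfying `ErratumHypotheses W p` (`5 ≤ p ∧ mult ∧ irr ∧` nonsplit-multiplicative ramified
  `q ≠ p ∧ E(ℚ_p)[p] = 0`).
So the typed input is "announced" exactly on (SZ-shape ∪ A′-shape) and has NO source, even
announced, elsewhere — in particular at `p = 3` (both binders carry `5 ≤ p`).

CENSUS (data, not claims; numbers, not adjectives; unit folder `HOME/b2b-bsdres-multr1-p2/szcensus/`;
engines gp 2.15 `szcensus.gp` and cypari2 `szcensus.py`, byte-identical on the smoke window `N < 2000`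
(jobs j086563 ≡ j086694); full run j086753; population = multr1-p1's census500k list = every
(class, `p ≥ 5`) with the class of rank `1`, `N < 5·10⁵`, `p ∥ N`, `E[p]` irreducible — the whole
X11b SHAPE, NOT the lane's residue). Of 2 267 348 pairs: `Locus` 2 093 111 (92.3 %); A′-shape
1 603 386; SZ-shape 2 037 828; A′ ∪ SZ 2 123 206 (93.6 %); **`Locus ∩ (A′ ∪ SZ)` 2 071 755 = 99.0 % of
`Locus`; `Locus` pairs with NO announced source 21 356** (failing SZ clause: (b2) `𝔏`-unit 16 387,
(b1) `p ∣ v_p(Δ)` 4 153, (d) 832); all pairs with no announced source 144 142 (6.4 %). By `p`: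
`Locus` without source 10 216 / 4 873 / 1 865 / 1 293 / 2 836 / 273 for `p = 5 / 7 / 11 / 13 / 17–97 /
≥ 101`. On the cell's in-window CORE rows (hyp `hyp_bits.tsv`, cls X11b, `N < 2·10⁴`): `p ≥ 5`: 143
rows, `Locus` 49, A′ 80, SZ 60, `Locus ∩ (A′ ∪ SZ)` 46, `Locus` without source 3, rows without source
43; `p = 3`: 628 rows, none with an announced source. Nothing booked; labels unchanged.

References: [SkinnerZhang2014] Thms. 1.1–1.2; [Castella2018Erratum] Thm. A′; [FouquetWan2021]
Thm. 4.41; [JetchevSkinnerWan2017] §7.4.1; [Skinner2016PacificMC] Thm. C; [Miller2011LMS] Def. 1.1.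
-/

noncomputable section

open scoped Classical

open WeierstrassCurve NumberField Literature.NumberTheory.EllipticCurves
  Literature.NumberTheory.EllipticCurves.ModularForms
  Literature.NumberTheory.EllipticCurves.Rank1Residual
  Literature.NumberTheory.EllipticCurves.Rank1Residual.Typed

namespace Summit.BirchSwinnertonDyer.Rank1Residual.X11b

/-- **STEP L on the Skinner–Zhang shape — CONDITIONAL on the OPEN binder
`SkinnerZhang2014.thm1_2_padicVal_bsd_rankOne_OPEN` (arXiv:1407.1099 Thm. 1.2, UNREFEREED).** For
`W/ℚ` globally minimal with `ord_{s=1} L(E,s) = 1`, `p ≥ 5`, hypotheses (a)–(e) of Skinner–Zhang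
Thm. 1.1 (`hH`; they give `mult(p)`, `irr(p)` and a (ram) prime, `ram_of_skinnerZhang_hypotheses`),
and ANY Heegner datum of the route (`K` imaginary quadratic, every `ℓ ∣ N` split, `p ∤ #𝓞_K^×`,
`L(E^{d_K},1) ≠ 0`, a parametrisation datum with `p ∤ c`, its Heegner point `P`, a minimal twist
model): `IndexLowerBoundAt W p K P`. Route: the binder gives `BSDp W p` (`bsdp_of_skinnerZhang_OPEN`),
whose lower half is STEP L at the datum (`indexLowerBoundAt_iff_missingLowerBoundAt_of_heegnerData`,
published facts `hGZ hKo hSk hGZK hmod`). NOT a theorem of the published record: CONDITIONAL on an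
unrefereed claim; nothing booked. [claim: SkinnerZhang2014, status: under-review]
[cite: JetchevSkinnerWan2017, §7.4.1 (pp. 30–31)] [cite: Miller2011LMS, Def. 1.1] -/
theorem indexLowerBoundAt_of_skinnerZhang_OPEN
    (hSZ : SkinnerZhang2014.thm1_2_padicVal_bsd_rankOne_OPEN)
    (W : WeierstrassCurve ℚ) [W.IsElliptic] [W.IsGloballyMinimal] (p : ℕ) [Fact p.Prime]
    [NeZero (W.conductorNorm ℤ)] (K : Type) [Field K] [NumberField K]
    (Dt : ModularParametrizationData W (W.conductorNorm ℤ))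
    (H : HeegnerDatum (W.conductorNorm ℤ) (NumberField.discr K)) (ι : K →+* ℂ)
    (P : (W.baseChange K).toAffine.Point)
    -- the published inputs (named facts of the tree)
    (hGZ : gross_zagier (W.conductorNorm ℤ) W K) (hKo : kolyvagin (W.conductorNorm ℤ) W K)
    (hSk : Skinner2016.thmC_padicValRat_bsd_rank_zero)
    (hGZK : rank_eq_analyticRank_of_analyticRank_le_one) (hmod : hasEntireLFunction_rat)
    -- the pair: Skinner–Zhang's shape, analytic rank one
    (hp5 : 5 ≤ p) (hH : SkinnerZhang2014.Hypotheses W p) (hr : W.analyticRank = 1)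
    -- the Heegner datum
    (hK : IsImaginaryQuadratic K) (hHN : SatisfiesHeegnerHypothesis (W.conductorNorm ℤ) K)
    (hP : WeierstrassCurve.Affine.Point.map ι.toRatAlgHom P = heegnerPointComplex Dt H)
    (hc : ¬ (p : ℤ) ∣ Dt.c) (hμ : ¬ p ∣ Units.torsionOrder K)
    (hLt : (W.quadraticTwist (NumberField.discr K : ℚ)).entireLFunction 1 ≠ 0)
    (Wd : WeierstrassCurve ℚ) [Wd.IsElliptic] [Wd.IsGloballyMinimal] (Cd : VariableChange ℚ)
    (hWd : Cd • W.quadraticTwist (NumberField.discr K : ℚ) = Wd) :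
    IndexLowerBoundAt W p K P := by
  have hbsd : BSDp W p := bsdp_of_skinnerZhang_OPEN W p hSZ hGZK hp5 hH hr
  haveI : Finite W.sha := (hGZK W (le_of_eq hr)).2
  have hlow : Typed.MissingLowerBoundAt W p :=
    (Typed.lower_and_upper_of_missingPPartAt W p (Typed.missingPPartAt_of_bsdp W p hbsd)).1
  exact (indexLowerBoundAt_iff_missingLowerBoundAt_of_heegnerData W p K Dt H ι P hGZ hKo hSk hGZK
    hmod hr hp5 hH.mult hH.irr (ram_of_skinnerZhang_hypotheses hH) hK hHN hP hc hμ hLt Wd Cd hWd).2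
    hlow

/-- **STEP L on the erratum-A′ shape — CONDITIONAL on the OPEN binder
`Castella2018.erratum_thmAprime_padicVal_bsd_rankOne_OPEN` (web erratum Thm. A′ = arXiv:2409.01360
Thm. 3.1; proof via Fouquet–Wan arXiv:2107.13726 Thm. 4.41, UNREFEREED).** For `W/ℚ` globally
minimal with `ord_{s=1} L(E,s) = 1` satisfying `ErratumHypotheses W p` (`5 ≤ p`, `mult(p)`, `irr(p)`,
a NONSPLIT multiplicative `q ≠ p` with `p ∤ v_q(Δ_min)`, `E(ℚ_p)[p] = 0`; a (ram) prime by
`X11.ram_of_aprimeLocusAt`) and ANY Heegner datum of the route as above: `IndexLowerBoundAt W p K P`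
(the binder gives `BSDp W p`, `bsdp_of_erratumHypotheses_of_thmAprime_OPEN`; its lower half is STEP
L at the datum). CONDITIONAL on an unrefereed claim; nothing booked.
[claim: Castella2018Erratum, status: under-review] [cite: JetchevSkinnerWan2017, §7.4.1 (pp. 30–31)]
[cite: Miller2011LMS, Def. 1.1] -/
theorem indexLowerBoundAt_of_thmAprime_OPEN
    (hA' : Castella2018.erratum_thmAprime_padicVal_bsd_rankOne_OPEN)
    (W : WeierstrassCurve ℚ) [W.IsElliptic] [W.IsGloballyMinimal] (p : ℕ) [Fact p.Prime]
    [NeZero (W.conductorNorm ℤ)] (K : Type) [Field K] [NumberField K]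
    (Dt : ModularParametrizationData W (W.conductorNorm ℤ))
    (H : HeegnerDatum (W.conductorNorm ℤ) (NumberField.discr K)) (ι : K →+* ℂ)
    (P : (W.baseChange K).toAffine.Point)
    -- the published inputs (named facts of the tree)
    (hGZ : gross_zagier (W.conductorNorm ℤ) W K) (hKo : kolyvagin (W.conductorNorm ℤ) W K)
    (hSk : Skinner2016.thmC_padicValRat_bsd_rank_zero)
    (hGZK : rank_eq_analyticRank_of_analyticRank_le_one) (hmod : hasEntireLFunction_rat)
    -- the pair: the erratum's shape, analytic rank one
    (h : ErratumHypotheses W p) (hr : W.analyticRank = 1)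
    -- the Heegner datum
    (hK : IsImaginaryQuadratic K) (hHN : SatisfiesHeegnerHypothesis (W.conductorNorm ℤ) K)
    (hP : WeierstrassCurve.Affine.Point.map ι.toRatAlgHom P = heegnerPointComplex Dt H)
    (hc : ¬ (p : ℤ) ∣ Dt.c) (hμ : ¬ p ∣ Units.torsionOrder K)
    (hLt : (W.quadraticTwist (NumberField.discr K : ℚ)).entireLFunction 1 ≠ 0)
    (Wd : WeierstrassCurve ℚ) [Wd.IsElliptic] [Wd.IsGloballyMinimal] (Cd : VariableChange ℚ)
    (hWd : Cd • W.quadraticTwist (NumberField.discr K : ℚ) = Wd) :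
    IndexLowerBoundAt W p K P := by
  obtain ⟨hp5, hmult, hirr, hloc⟩ := h
  have hbsd : BSDp W p :=
    bsdp_of_erratumHypotheses_of_thmAprime_OPEN W p hA' hGZK ⟨hp5, hmult, hirr, hloc⟩ hr
  haveI : Finite W.sha := (hGZK W (le_of_eq hr)).2
  have hlow : Typed.MissingLowerBoundAt W p :=
    (Typed.lower_and_upper_of_missingPPartAt W p (Typed.missingPPartAt_of_bsdp W p hbsd)).1
  exact (indexLowerBoundAt_iff_missingLowerBoundAt_of_heegnerData W p K Dt H ι P hGZ hKo hSk hGZK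
    hmod hr hp5 hmult hirr (X11.ram_of_aprimeLocusAt hloc) hK hHN hP hc hμ hLt Wd Cd hWd).2 hlow

/-- **Outside the two shapes nothing announced applies — in particular at `p = 3`**: both OPEN
binders are typed with `5 ≤ p`, so at `p = 3` neither `ErratumHypotheses W 3` holds nor can
`bsdp_of_skinnerZhang_OPEN` be invoked (its `hp : 5 ≤ p`). Recorded as the trivial kernel fact
`¬ ErratumHypotheses W 3`. [folklore] -/
theorem not_erratumHypotheses_three (W : WeierstrassCurve ℚ) [W.IsElliptic] [W.IsGloballyMinimal] :
    ¬ ErratumHypotheses W 3 := fun h ↦ by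
  have h5 : 5 ≤ 3 := h.1
  omega

end Summit.BirchSwinnertonDyer.Rank1Residual.X11b

end
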